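/-
HONEST FRAMING: certified error envelopes and provably optimal rounding/accumulation schemes for
low-precision formats under stated cost models; every table by two implementations; no hardware
or vendor claims.
-/
import Summits.Ventures.CertifiedArithmetic.LowPrec.OptDemotionWitness
import Summits.Ventures.CertifiedArithmetic.LowPrec.OptTreePolyFormats

/-!
# The demotion law (Theorem T8): the tie hypotheses hold for the formats' round-to-nearest-even

The sharpness statements of OPTIMA §B Theorem T8 (`demotion_sequential_attained`, part 2, and the
every-tree witness of part 4) are conditional on how the wide rounding `fl_q` resolves two kinds
of ties: `TiesEvenAtPow q` (the binade midpoints `2^e(1+u_q) ↦ 2^e`) and `TiesDownAtShift p q`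
(the shifted midpoints `2^e(1+u_p) + 2^e u_q ↦ 2^e(1+u_p)`), plus `TiesDownAtShift (q-p) q` for the
`R`-type nodes.  Part 2 constructs abstract nearest maps with ONE such property.  THIS FILE shows
that the ACTUAL rounding of every format of the venture has them all: for a format `φ` with
`q = m + 1` significand bits, the Jeannerod–Rump model rounding `φ.flJR` (= `roundNE φ` in range,
`RoundNearestJR`; ties-to-even, gradual underflow, no overflow) satisfies

* `TiesEvenAtPow (m+1) (qexp φ) φ.flJR` — `OptTreePolyFormats.tiesEvenAtPow_flJR` (recalled);
* `TiesDownAtShift p (m+1) (qexp φ) φ.flJR` for every `1 ≤ p` with `p + 2 ≤ m + 1`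
  (`tiesDownAtShift_flJR`: the scaled value is `2^m + 2^(m-p) + ½`, an exact tie whose even side is
  `2^m + 2^(m-p)` because `m - p ≥ 1`) — in particular for `p` AND for `q - p` when `2 ≤ p`,
  `p + 2 ≤ q` (`demotion_ties_flJR`).

So for every pair of formats (narrow `p = m_β + 1 ≥ 2` bits, wide `q = m_α + 1 ≥ p + 2` bits) the
hypotheses of T8's sharpness theorems are met by round-to-nearest-even itself: the demotion
witnesses are realised by genuine ties-to-even arithmetic, not only by abstract nearest maps.
[cite: IEEE7542019, §4.3.1]
-/

namespace Literature.ComputerArithmetic.FloatingPoint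

open Literature.ComputerArithmetic.JeannerodRump2018

namespace Format

variable {φ : Format}

/-- THE SHIFTED TIE GOES DOWN UNDER TIES-TO-EVEN: for `1 ≤ p`, `p + 2 ≤ m + 1` and
`E ≥ qexp φ + (m+1)`, `flJR φ (2^E + 2^E·u_p + 2^E·u_(m+1)) = 2^E + 2^E·u_p` — the point is the
exact midpoint of the consecutive floats `2^E(1+u_p)` and `2^E(1+u_p+2u_(m+1))`, and the lower
one has the even significand `2^m + 2^(m-p)`. [cite: IEEE7542019, §4.3.1] -/
theorem flJR_shifted_tie {p : ℕ} (hp : 1 ≤ p) (hpq : p + 2 ≤ φ.manBits + 1) {E : ℤ}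
    (hE : φ.qexp + ((φ.manBits + 1 : ℕ) : ℤ) ≤ E) :
    φ.flJR ((2 : ℚ) ^ E + (2 : ℚ) ^ E * (1 / 2 ^ p) + (2 : ℚ) ^ E * (1 / 2 ^ (φ.manBits + 1)))
      = (2 : ℚ) ^ E + (2 : ℚ) ^ E * (1 / 2 ^ p) := by
  have h2 : (2 : ℚ) ≠ 0 := by norm_num
  have h2E : (0 : ℚ) < (2 : ℚ) ^ E := zpow_pos (by norm_num) E
  have hP : (0 : ℚ) < 2 ^ p := by positivity
  have hQ : (0 : ℚ) < 2 ^ (φ.manBits + 1) := by positivity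
  set x : ℚ := (2 : ℚ) ^ E + (2 : ℚ) ^ E * (1 / 2 ^ p) + (2 : ℚ) ^ E * (1 / 2 ^ (φ.manBits + 1))
    with hx_def
  have hxpos : 0 < x := by positivity
  have habs : |x| = x := abs_of_pos hxpos
  -- `u_p + u_q < 1`, so `⌊log₂ x⌋ = E`
  have hup : (1 : ℚ) / 2 ^ p ≤ 1 / 2 := by
    have : (2 : ℚ) ^ 1 ≤ 2 ^ p := pow_le_pow_right₀ (by norm_num) hp
    exact one_div_le_one_div_of_le (by norm_num) (by simpa using this)
  have huq : (1 : ℚ) / 2 ^ (φ.manBits + 1) ≤ 1 / 8 := by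
    have : (2 : ℚ) ^ 3 ≤ 2 ^ (φ.manBits + 1) := pow_le_pow_right₀ (by norm_num) (by omega)
    exact one_div_le_one_div_of_le (by norm_num) (by norm_num at this ⊢; exact this)
  have hlog : Int.log 2 |x| = E := by
    rw [habs]
    have hlo : ((2 : ℕ) : ℚ) ^ E ≤ x := by
      rw [Nat.cast_ofNat, hx_def]
      have : 0 ≤ (2 : ℚ) ^ E * (1 / 2 ^ p) + (2 : ℚ) ^ E * (1 / 2 ^ (φ.manBits + 1)) := by
        positivity
      linarith
    have hhi : x < ((2 : ℕ) : ℚ) ^ (E + 1) := by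
      rw [Nat.cast_ofNat, zpow_add₀ h2, zpow_one, hx_def]
      have h1 : (2 : ℚ) ^ E * (1 / 2 ^ p) ≤ (2 : ℚ) ^ E * (1 / 2) :=
        mul_le_mul_of_nonneg_left hup h2E.le
      have h3 : (2 : ℚ) ^ E * (1 / 2 ^ (φ.manBits + 1)) ≤ (2 : ℚ) ^ E * (1 / 8) :=
        mul_le_mul_of_nonneg_left huq h2E.le
      linarith
    have h1 := (Int.zpow_le_iff_le_log (b := 2) (by norm_num) hxpos).mp hlo
    have h3 := (Int.lt_zpow_iff_log_lt (b := 2) (by norm_num) hxpos).mp hhi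
    omega
  rw [flJR_of_nonneg hxpos.le]
  unfold flJRMag
  rw [habs]
  unfold gridExp
  rw [hlog]
  have hbig : φ.qexp ≤ E - φ.manBits := by push_cast at hE; omega
  rw [max_eq_right hbig]
  -- the scaled value is the exact tie `(2^m + 2^(m-p)) + 1/2`
  obtain ⟨d, hd⟩ : ∃ d : ℕ, φ.manBits = p + d + 1 := ⟨φ.manBits - p - 1, by omega⟩
  have hscale : x / (2 : ℚ) ^ (E - (φ.manBits : ℤ))
      = ((2 ^ φ.manBits + 2 ^ (d + 1) : ℤ) : ℚ) + 1 / 2 := by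
    rw [div_eq_iff (zpow_pos (by norm_num : (0 : ℚ) < 2) _).ne', hx_def,
      show (E : ℤ) = (E - φ.manBits) + (φ.manBits : ℕ) by ring, zpow_add₀ h2, zpow_natCast]
    push_cast
    rw [show (E - (φ.manBits : ℤ) + (φ.manBits : ℤ) - (φ.manBits : ℤ)) = E - (φ.manBits : ℤ) by ring,
      hd, show p + d + 1 + 1 = p + (d + 2) by ring, pow_add, pow_add]
    field_simp
    ring
  have heven : (2 : ℤ) ∣ 2 ^ φ.manBits + 2 ^ (d + 1) :=
    dvd_add (dvd_pow_self 2 (by omega)) (dvd_pow_self 2 (by omega))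
  rw [hscale, rneInt_intCast_add_half_of_even heven]
  push_cast
  rw [add_mul, ← zpow_natCast, ← zpow_natCast, ← zpow_add₀ h2, ← zpow_add₀ h2]
  have hEp : ((d + 1 : ℕ) : ℤ) + (E - (φ.manBits : ℤ)) = E - p := by push_cast; omega
  rw [show ((φ.manBits : ℕ) : ℤ) + (E - (φ.manBits : ℤ)) = E by ring, hEp,
    zpow_sub₀ h2, zpow_natCast]
  field_simp

end Format

end Literature.ComputerArithmetic.FloatingPoint

namespace Summit.Ventures.CertifiedArithmetic.LowPrec.Opt

open Literature.ComputerArithmetic.JeannerodRump2018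
open Literature.ComputerArithmetic.FloatingPoint

/-- `TiesDownAtShift p (m+1) (qexp φ) (flJR φ)` for every `1 ≤ p` with `p + 2 ≤ m + 1`: the wide
rounding of every format resolves the shifted ties of the demotion witnesses downwards (to even).
[cite: IEEE7542019, §4.3.1] -/
theorem tiesDownAtShift_flJR (φ : Format) {p : ℕ} (hp : 1 ≤ p) (hpq : p + 2 ≤ φ.manBits + 1) :
    TiesDownAtShift p (φ.manBits + 1) φ.qexp φ.flJR := by
  intro e he
  have h := Format.flJR_shifted_tie (φ := φ) hp hpq (by exact_mod_cast he)
  unfold unitRoundoff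
  exact h

/-- All three tie hypotheses of the every-tree demotion witness at once: for `2 ≤ p` and
`p + 2 ≤ q = m + 1`, `flJR φ` satisfies `TiesDownAtShift p q`, `TiesDownAtShift (q - p) q` (because
`(q - p) + 2 ≤ q` iff `2 ≤ p`) and `TiesEvenAtPow q`. -/
theorem demotion_ties_flJR (φ : Format) {p : ℕ} (hp : 2 ≤ p) (hpq : p + 2 ≤ φ.manBits + 1) :
    TiesDownAtShift p (φ.manBits + 1) φ.qexp φ.flJR ∧
    TiesDownAtShift (φ.manBits + 1 - p) (φ.manBits + 1) φ.qexp φ.flJR ∧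
    TiesEvenAtPow (φ.manBits + 1) φ.qexp φ.flJR :=
  ⟨tiesDownAtShift_flJR φ (by omega) hpq, tiesDownAtShift_flJR φ (by omega) (by omega),
    tiesEvenAtPow_flJR φ (by omega)⟩

/-- Kernel cross-check in a real pair of formats (binary16: `q = 11`; narrow `p = 8` as for
bfloat16): the shifted ties at `E = 0` go down under the executable `roundNE` — `1 + 2^-8 + 2^-11
↦ 1 + 2^-8` (type `Q`) and `1 + 2^-3 + 2^-11 ↦ 1 + 2^-3` (type `R`, `q - p = 3`) — and the binade
tie `1 + 2^-11 ↦ 1` (type `M`). -/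
theorem shifted_ties_binary16_kernel :
    MiniFloat.flα Format.Binary16 (1 + 1/256 + 1/2048) = 1 + 1/256 ∧
    MiniFloat.flα Format.Binary16 (1 + 1/8 + 1/2048) = 1 + 1/8 ∧
    MiniFloat.flα Format.Binary16 (1 + 1/2048) = 1 := by
  refine ⟨by decide +kernel, by decide +kernel, by decide +kernel⟩

end Summit.Ventures.CertifiedArithmetic.LowPrec.Opt
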